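import Literature.IUT.LogVolume.Corollary22Legendre
import Literature.IUT.LogVolume.Corollary22PartIILemmas
import Literature.IUT.LogVolume.Corollary22TwoAdicIntegrality
import Literature.IUT.LogVolume.Corollary22PrimeChoice
import Literature.IUT.LogVolume.Corollary22CMLocus
import Literature.IUT.LogVolume.Corollary22PartI
import HarnessLib

/-!
# [IUTchIV] Corollary 2.2 (ii), proof: the pointwise arithmetic on the `λ`-line

Mochizuki, *Inter-universal Teichmüller theory IV*, RIMS manuscript (Apr. 2020; = PRIMS **57** (2021)),
proof of Cor. 2.2 (ii), pp. 43–48. PROOF-ONLY companion of `Corollary22Legendre.lean` (no definitions):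
the elementary facts about one point `λ ∈ U_X(F_tpd)` that the assembly of (ii) uses —

* `coe_badPlaces_subset_condSupport`: the places of potentially multiplicative reduction (poles of
  `j(λ)`) are places where `λ` meets `{0, 1, ∞}` (pp. 43, 48; the inequality "`log(𝔣^{F_tpd}) ≤
  log-cond_D(x_E)`" itself is `logCondAvoid_le_logCond` of `Corollary22PartIILemmas.lean`);
* `logQNotTwo_sub_logQAvoid_le`: "`(1/6)·log(q^{∤2}) − (1/6)·log(q) ≤ (1/6)·h^{1/2}·log(l)`" from (P3)
  (p. 47, "together with the computation of the discussion preceding (P5)": the two divisors differ at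
  the places over `l`, where `h_v < h^{1/2}` and `Σ_{v∣l} f_v·log(l) ≤ [F:ℚ]·log(l)`);
* `exists_prime_P1_P2_P3_point`: the prime `l` of (P1), (P2), (P3) (p. 45) for the point, by
  instantiating the tree's `Cor22.PrimeChoiceData.exists_prime_P1_P2_P3` at the bad places of `λ`
  over `F_tpd` with `h_v = max(0, −ord_v j(λ))`, `f_v`, `p_v`, `[F_tpd:ℚ]·h = Σ_v h_v·f_v·log(p_v)`;
* `logQForall_le_of_core_exceptional`: `log(q^∀) ≤ 8` at the four `j`-invariants without core (their
  denominators are `5^3`, `3^4`, `1`, `1`), and `hasFinitelyManyPoints_inU_jInv_eq`: the points of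
  `U_X` with a given rational `j`-invariant have finitely many points (roots of `2^8(λ²−λ+1)³ −
  q·λ²(λ−1)²`), i.e. the first enlargement of `Exc_d` (p. 43);
* `h_le_of_le_add_sqrt_mul_log`: the real-variable form of the (P5) exclusion (p. 46).

Companion of `Corollary22PartIILemmas.lean` (abc-iut-S3), which it imports for `dmod_le_degree`,
`mem_badPlaces_iff_ord_neg`, `logQAvoid_pair_eq_zero_of_not_condP5`, `logQForall_le_of_jInv_eq_div`,
`logCondAvoid_le_logCond` (revision 2: the duplicated declarations of revision 1 are removed/renamed so
that both modules can be imported together). Classical bookkeeping; TAKES NO SIDE on [IUTchIII] Cor.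
3.12 (no Θ-data occur here).
-/

noncomputable section

namespace Literature.IUT.LogVolume

namespace Cor22

open NumberField IsDedekindDomain Literature.NumberTheory.DiophantineGeometry.GenEll Real Finset
open Polynomial

/-! ## Bad places lie in the support of the conductor -/

/-- If `λ` and `λ − 1` are units at `v`, then `j(λ) = 2^8(λ²−λ+1)³/(λ²(λ−1)²)` is integral at `v`.
[claim: Mochizuki2012, status: disputed] -/
theorem valuation_jInv_le_one {F : Type*} [Field F] [NumberField F] (v : HeightOneSpectrum (𝓞 F))
    {t : F} (h0 : v.valuation F t = 1) (h1 : v.valuation F (t - 1) = 1) :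
    v.valuation F (jInv t) ≤ 1 := by
  have h2 : v.valuation F (2 : F) ≤ 1 := by
    have h := v.valuation_le_one (K := F) (2 : 𝓞 F)
    exact_mod_cast h
  have ht : v.valuation F t ≤ 1 := h0.le
  have ht2 : v.valuation F (t ^ 2) ≤ 1 := by
    rw [map_pow]; exact pow_le_one₀ zero_le ht
  have hq : v.valuation F (t ^ 2 - t + 1) ≤ 1 :=
    Valuation.map_add_le _ (Valuation.map_sub_le _ ht2 ht) (le_of_eq (map_one _))
  unfold jInv
  rw [map_div₀, map_mul, map_pow, map_pow, map_mul, map_pow, map_pow, h0, h1, one_pow, mul_one,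
    div_one]
  exact mul_le_one' (pow_le_one₀ zero_le h2) (pow_le_one₀ zero_le hq)

/-- A bad place of `λ` (a pole of `j(λ)`: potentially multiplicative reduction) is a place at which `λ`
meets `0`, `1` or `∞`, i.e. lies in the support of the conductor `log-cond_{[0]+[1]+[∞]}(λ)` (p. 43).
[claim: Mochizuki2012, status: disputed] -/
theorem coe_badPlaces_subset_condSupport (P : NFPoint) : ↑(badPlaces P) ⊆ P.condSupport := by
  intro v hv
  rw [Finset.mem_coe, badPlaces, Set.Finite.mem_toFinset] at hv
  change 1 < v.valuation P.F (jInv P.x) at hv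
  simp only [NFPoint.condSupport, Set.mem_setOf_eq]
  by_contra hnot
  simp only [not_or, not_lt] at hnot
  obtain ⟨ha, hb, hc⟩ := hnot
  have h0 : v.valuation P.F P.x = 1 := le_antisymm hb ha
  have h1 : v.valuation P.F (P.x - 1) = 1 :=
    le_antisymm (Valuation.map_sub_le _ h0.le (le_of_eq (map_one _))) hc
  exact absurd (valuation_jInv_le_one v h0 h1) (not_le.mpr hv)

/-! ## Bad places through `ord_v(j(λ))` -/

/-- The local height as an integer: `h_v = −ord_v(j(λ))` at a bad place.
[claim: Mochizuki2012, status: disputed] -/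
theorem localHeight_eq_neg_ord {P : NFPoint} {v : HeightOneSpectrum (𝓞 P.F)} (hv : v ∈ badPlaces P) :
    localHeight P v = -(ord P.F v (jInv P.x) : ℝ) := by
  have h := (mem_badPlaces_iff_ord_neg P v).mp hv
  unfold localHeight
  have : ((-(ord P.F v (jInv P.x))).toNat : ℤ) = -(ord P.F v (jInv P.x)) := Int.toNat_of_nonneg (by omega)
  exact_mod_cast this

/-! ## Splitting `log(q^{∤2})` at the prime `l` -/

open scoped Classical in
/-- `[F:ℚ]·(log(q^{∤2}) − log(q^{∤{2,l}})) = Σ_{v bad, v ∤ 2, v ∣ l} h_v·log N(v)`: the two `q`-parameter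
divisors differ exactly at the bad places over `l` (p. 46–47, "the computation of the discussion
preceding (P5)"). [claim: Mochizuki2012, status: disputed] -/
theorem degree_mul_logQNotTwo_sub_logQAvoid (P : NFPoint) (l : ℕ) :
    (P.degree : ℝ) * (logQNotTwo P - logQAvoid P {2, l}) =
      ∑ v ∈ (badPlaces P).filter (fun v => (2 : 𝓞 P.F) ∉ v.asIdeal ∧ ((l : ℕ) : 𝓞 P.F) ∈ v.asIdeal),
        localHeight P v * logNorm P.F v := by
  set B2 := (badPlaces P).filter (fun v => (2 : 𝓞 P.F) ∉ v.asIdeal) with hB2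
  have hq2 : qDivisor P {2} = ∑ v ∈ B2, FinDivisor.of v (localHeight P v) := by
    unfold qDivisor
    refine Finset.sum_congr (Finset.filter_congr fun v _ => ?_) fun _ _ => rfl
    simp
  have hq2l : qDivisor P {2, l} =
      ∑ v ∈ B2.filter (fun v => ((l : ℕ) : 𝓞 P.F) ∉ v.asIdeal), FinDivisor.of v (localHeight P v) := by
    unfold qDivisor
    rw [hB2, Finset.filter_filter]
    refine Finset.sum_congr (Finset.filter_congr fun v _ => ?_) fun _ _ => rfl
    simp
  have hsplit : qDivisor P {2} = qDivisor P {2, l} +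
      ∑ v ∈ B2.filter (fun v => ((l : ℕ) : 𝓞 P.F) ∈ v.asIdeal), FinDivisor.of v (localHeight P v) := by
    rw [hq2, hq2l, ← Finset.sum_filter_add_sum_filter_not B2 (fun v => ((l : ℕ) : 𝓞 P.F) ∈ v.asIdeal),
      add_comm]
  have hset : B2.filter (fun v => ((l : ℕ) : 𝓞 P.F) ∈ v.asIdeal) =
      (badPlaces P).filter (fun v => (2 : 𝓞 P.F) ∉ v.asIdeal ∧ ((l : ℕ) : 𝓞 P.F) ∈ v.asIdeal) := by
    rw [hB2, Finset.filter_filter]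
  have hn : (0 : ℝ) < Module.finrank ℚ P.F := FinDivisor.finrank_pos
  unfold logQNotTwo logQAvoid NFPoint.degree
  rw [hsplit, map_add, FinDivisor.ndeg_apply, FinDivisor.ndeg_apply, FinDivisor.deg_sum_of, hset]
  field_simp
  ring

/-- **"`(1/6)·log(q^{∤2}) − (1/6)·log(q) ≤ (1/6)·h^{1/2}·log(l)`"** (p. 47), in the form: if the local
heights at the bad places of residue characteristic `l` are `≤ s` (for (P3): `h_v < h^{1/2}`), then
`log(q^{∤2}) − log(q^{∤{2,l}}) ≤ s·log(l)` — since `Σ_{v ∣ l} f_v·log(l) ≤ Σ_{v ∣ l} e_v f_v·log(l) =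
[F:ℚ]·log(l)`. [claim: Mochizuki2012, status: disputed] -/
theorem logQNotTwo_sub_logQAvoid_le (P : NFPoint) {l : ℕ} (hl : l.Prime) {s : ℝ} (hs : 0 ≤ s)
    (hP3 : ∀ v ∈ badPlaces P, residueChar P.F v = l → localHeight P v ≤ s) :
    logQNotTwo P - logQAvoid P {2, l} ≤ s * Real.log l := by
  classical
  haveI : Fact l.Prime := ⟨hl⟩
  have hn : (0 : ℝ) < P.degree := by exact_mod_cast P.degree_pos
  have hlog : 0 ≤ Real.log l := Real.log_nonneg (by exact_mod_cast hl.one_lt.le)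
  have key := degree_mul_logQNotTwo_sub_logQAvoid P l
  set T := (badPlaces P).filter (fun v => (2 : 𝓞 P.F) ∉ v.asIdeal ∧ ((l : ℕ) : 𝓞 P.F) ∈ v.asIdeal)
  have hsub : T ⊆ placesOver P.F l := fun v hv =>
    mem_placesOver_of_natCast_mem l v (Finset.mem_filter.mp hv).2.2
  have hterm : ∀ v ∈ T, localHeight P v * logNorm P.F v ≤ s * Real.log l * (localDegree P.F v : ℝ) := by
    intro v hv
    have hvb : v ∈ badPlaces P := (Finset.mem_filter.mp hv).1
    have hres : residueChar P.F v = l := (mem_placesOver_iff_residueChar v).mp (hsub hv)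
    have hlh : localHeight P v ≤ s := hP3 v hvb hres
    have hln : logNorm P.F v = resDeg P.F v * Real.log l := by rw [logNorm_eq, hres]
    have hf : (resDeg P.F v : ℝ) ≤ localDegree P.F v := by
      have : resDeg P.F v ≤ localDegree P.F v := by
        unfold localDegree
        exact Nat.le_mul_of_pos_left _ (Nat.pos_of_ne_zero (ramIdx_ne_zero P.F v))
      exact_mod_cast this
    rw [hln]
    calc localHeight P v * (resDeg P.F v * Real.log l)
        ≤ s * (resDeg P.F v * Real.log l) :=
          mul_le_mul_of_nonneg_right hlh (by positivity)
      _ = s * Real.log l * resDeg P.F v := by ring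
      _ ≤ s * Real.log l * localDegree P.F v := mul_le_mul_of_nonneg_left hf (by positivity)
  have hsum : (P.degree : ℝ) * (logQNotTwo P - logQAvoid P {2, l}) ≤ s * Real.log l * P.degree := by
    rw [key]
    calc ∑ v ∈ T, localHeight P v * logNorm P.F v
        ≤ ∑ v ∈ T, s * Real.log l * (localDegree P.F v : ℝ) := Finset.sum_le_sum hterm
      _ ≤ ∑ v ∈ placesOver P.F l, s * Real.log l * (localDegree P.F v : ℝ) :=
          Finset.sum_le_sum_of_subset_of_nonneg hsub fun v _ _ => by positivity
      _ = s * Real.log l * ∑ v ∈ placesOver P.F l, (localDegree P.F v : ℝ) := by rw [Finset.mul_sum]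
      _ = s * Real.log l * P.degree := by
          rw [← Nat.cast_sum, sum_localDegree]; rfl
  nlinarith

/-- `log(q^{∤{2,l}}) ≤ log(q^{∤2}) ≤ log(q^∀) = h` (the divisors are successively larger).
[claim: Mochizuki2012, status: disputed] -/
theorem logQAvoid_le_logQNotTwo_le (P : NFPoint) (l : ℕ) :
    logQAvoid P {2, l} ≤ logQNotTwo P ∧ logQNotTwo P ≤ logQForall P :=
  ⟨logQAvoid_anti P (Finset.singleton_subset_iff.mpr (Finset.mem_insert_self 2 {l})),
    logQAvoid_anti P (Finset.empty_subset _)⟩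

/-! ## `log(q^∀)` at a rational `j`-invariant with prime-power denominator -/

/-- `[F:ℚ]·log(q^∀(λ)) = Σ_{v bad} h_v·log N(v)`. [claim: Mochizuki2012, status: disputed] -/
theorem degree_mul_logQForall_eq_sum_logNorm (P : NFPoint) :
    (P.degree : ℝ) * logQForall P = ∑ v ∈ badPlaces P, localHeight P v * logNorm P.F v := by
  classical
  rw [degree_mul_logQForall]
  unfold qDivisor
  rw [Finset.filter_true_of_mem (fun v _ => by simp), FinDivisor.deg_sum_of]

/-- `log 5 ≤ 2` (since `5 ≤ e²`). [folklore] -/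
private theorem log_five_le_two' : Real.log 5 ≤ 2 := by
  have he := Real.exp_one_gt_d9
  have h5 : (5 : ℝ) ≤ Real.exp 2 := by
    have : Real.exp 2 = Real.exp 1 * Real.exp 1 := by rw [← Real.exp_add]; norm_num
    rw [this]; nlinarith
  calc Real.log 5 ≤ Real.log (Real.exp 2) := Real.log_le_log (by norm_num) h5
    _ = 2 := Real.log_exp 2

/-- **At the four `j`-invariants without core, `log(q^∀) ≤ 8`** (the denominators are `5^3`, `3^4`, `1`,
`1`, so `log(q^∀) ≤ 3·log 5`, `4·log 3`, `0`, `0`; cf. Mochizuki–Fesenko–Hoshi–Minamide–Porowski,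
Cor. 5.2, proof: "`log(q^∀) ≤ max{log(5^3), log(3^4)}`" on these points). [claim: Mochizuki2012, status: disputed] -/
theorem logQForall_le_of_core_exceptional (P : NFPoint) {q : ℚ} (hq : q ∈ coreExceptionalJ)
    (hj : jInv P.x = (q : P.F)) : logQForall P ≤ 8 := by
  have hl5 := log_five_le_two'
  have hl3 : Real.log 3 ≤ 2 := le_trans (Real.log_le_log (by norm_num) (by norm_num)) hl5
  simp only [coreExceptionalJ, Finset.mem_insert, Finset.mem_singleton] at hq
  rcases hq with rfl | rfl | rfl | rfl
  · -- `2^14·31^3/5^3`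
    have hj' : jInv P.x = ((488095744 : ℤ) : P.F) / ((5 : ℕ) : P.F) ^ 3 := by
      rw [hj]; push_cast; norm_num
    have := logQForall_le_of_jInv_eq_div P (by norm_num) 3 hj'
    push_cast at this
    linarith
  · -- `2^2·73^3/3^4`
    have hj' : jInv P.x = ((1556068 : ℤ) : P.F) / ((3 : ℕ) : P.F) ^ 4 := by
      rw [hj]; push_cast; norm_num
    have := logQForall_le_of_jInv_eq_div P (by norm_num) 4 hj'
    push_cast at this
    linarith
  · -- `1728`
    have hj' : jInv P.x = 1728 := by rw [hj]; push_cast; norm_num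
    rw [logQForall_eq_zero_of_jInv_zero_or_1728 (Or.inr hj')]; norm_num
  · -- `0`
    have hj' : jInv P.x = 0 := by rw [hj]; push_cast; norm_num
    rw [logQForall_eq_zero_of_jInv_zero_or_1728 (Or.inl hj')]; norm_num

/-! ## Points with a prescribed rational `j`-invariant are finitely many -/

/-- **The fibre of `j` over a rational value has finitely many points**: the points `λ ∈ U_X` with
`j(λ) = q` (`q ∈ ℚ`) are roots of the nonzero polynomial `2^8(X²−X+1)³ − q·X²(X−1)² ∈ ℚ[X]`, so they have
finitely many minimal polynomials (all degrees at once). [claim: Mochizuki2012, status: disputed] -/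
theorem hasFinitelyManyPoints_inU_jInv_eq (q : ℚ) :
    HasFinitelyManyPoints {P : NFPoint | P.InU ∧ jInv P.x = (q : P.F)} := by
  classical
  set G : ℚ[X] := C (2 ^ 8 : ℚ) * (X ^ 2 - X + 1) ^ 3 - C q * (X ^ 2 * (X - 1) ^ 2) with hGdef
  have hG0 : G ≠ 0 := by
    intro h
    have := congrArg (fun p : ℚ[X] => p.eval 0) h
    simp [hGdef] at this
  have hroot : ∀ P : NFPoint, P.InU → jInv P.x = (q : P.F) → aeval P.x G = 0 := by
    intro P hU hj
    have hden : P.x ^ 2 * (P.x - 1) ^ 2 ≠ 0 :=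
      mul_ne_zero (pow_ne_zero 2 hU.1) (pow_ne_zero 2 (sub_ne_zero.2 hU.2))
    unfold jInv at hj
    rw [div_eq_iff hden] at hj
    simp only [hGdef, map_sub, map_mul, map_pow, map_add, aeval_C, aeval_X, map_one,
      eq_ratCast]
    push_cast
    linear_combination hj
  refine ((UniqueFactorizationMonoid.normalizedFactors G).toFinset.finite_toSet).subset ?_
  rintro _ ⟨P, ⟨hU, hj⟩, rfl⟩
  have hint : IsIntegral ℚ P.x := Algebra.IsIntegral.isIntegral P.x
  have hdvd : NFPoint.mpoly P ∣ G := minpoly.dvd ℚ P.x (hroot P hU hj)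
  have hirr : Irreducible (NFPoint.mpoly P) := minpoly.irreducible hint
  obtain ⟨r, hr, hassoc⟩ := UniqueFactorizationMonoid.exists_mem_normalizedFactors_of_dvd hG0 hirr hdvd
  have hnorm : normalize (NFPoint.mpoly P) = NFPoint.mpoly P :=
    (minpoly.monic hint).normalize_eq_self
  have hr' : NFPoint.mpoly P = r := by
    rw [← hnorm, ← UniqueFactorizationMonoid.normalize_normalized_factor r hr]
    exact normalize_eq_normalize hassoc.dvd hassoc.symm.dvd
  simp only [Multiset.mem_toFinset, Finset.mem_coe]
  rw [hr']
  exact hr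

/-- The points of `U_X` whose `j`-invariant is one of the four core-exceptional values have finitely
many points (the first enlargement of `Exc_d`, p. 43: "the [finite!] collection of points corresponding
to these four `j`-invariants"). [claim: Mochizuki2012, status: disputed] -/
theorem hasFinitelyManyPoints_not_admitsCore :
    HasFinitelyManyPoints {P : NFPoint | P.InU ∧ ¬ AdmitsCore P} := by
  have h4 : HasFinitelyManyPoints (({P : NFPoint | P.InU ∧ jInv P.x = ((488095744 / 125 : ℚ) : P.F)} ∪
      {P : NFPoint | P.InU ∧ jInv P.x = ((1556068 / 81 : ℚ) : P.F)}) ∪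
      ({P : NFPoint | P.InU ∧ jInv P.x = ((1728 : ℚ) : P.F)} ∪
      {P : NFPoint | P.InU ∧ jInv P.x = ((0 : ℚ) : P.F)})) :=
    ((hasFinitelyManyPoints_inU_jInv_eq _).union (hasFinitelyManyPoints_inU_jInv_eq _)).union
      ((hasFinitelyManyPoints_inU_jInv_eq _).union (hasFinitelyManyPoints_inU_jInv_eq _))
  refine h4.mono ?_
  rintro P ⟨hU, hnot⟩
  simp only [AdmitsCore, coreExceptionalJ, Finset.mem_insert, Finset.mem_singleton, not_forall,
    not_not, exists_prop] at hnot
  obtain ⟨q, hq, hj⟩ := hnot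
  rcases hq with rfl | rfl | rfl | rfl
  · exact Or.inl (Or.inl ⟨hU, hj⟩)
  · exact Or.inl (Or.inr ⟨hU, hj⟩)
  · exact Or.inr (Or.inl ⟨hU, hj⟩)
  · exact Or.inr (Or.inr ⟨hU, hj⟩)

/-! ## The prime `l` of (P1), (P2), (P3) for the point `λ` -/

open scoped Classical in
/-- **(P1), (P2), (P3) for the point `λ`** (p. 45), with the bookkeeping of p. 44 over `F_tpd`: the tree's
`Cor22.PrimeChoiceData.exists_prime_P1_P2_P3` instantiated with `V` = the bad places of `λ`, `h_v = max(0,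
−ord_v j(λ))`, `f_v`, `p_v`, `[F_tpd:ℚ] ≤ d ≤ δ = 2^{12}·3^3·5·d`, `h = log(q^∀(λ))`,
`[F_tpd:ℚ]·h = Σ_v h_v·f_v·log(p_v)`, under "`h^{1/2} ≥ ξ_prm`" (p. 44). Gives a prime `l` with
(P1) `h^{1/2} ≤ l ≤ 10δ·h^{1/2}·log(2δ·h)`, (P2) (`CondP2`) and (P3) `p_v = l ⟹ h_v < h^{1/2}`.
[claim: Mochizuki2012, status: disputed] -/
theorem exists_prime_P1_P2_P3_point (P : NFPoint) {d : ℕ} (hdeg : P.degree ≤ d) {ξ : ℝ}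
    (hξ : IsXiPrm ξ) (hξh : ξ ≤ Real.sqrt (logQForall P)) :
    ∃ l : ℕ, l.Prime ∧ Real.sqrt (logQForall P) ≤ l ∧
      (l : ℝ) ≤ 10 * delta d * Real.sqrt (logQForall P) * Real.log (2 * delta d * logQForall P) ∧
      CondP2 P l ∧
      ∀ v ∈ badPlaces P, residueChar P.F v = l → localHeight P v < Real.sqrt (logQForall P) := by
  have hd1 : 1 ≤ d := le_trans P.degree_pos hdeg
  have hd1' : (1 : ℝ) ≤ d := by exact_mod_cast hd1
  let A : PrimeChoiceData :=
    { ι := HeightOneSpectrum (𝓞 P.F)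
      instDecEq := inferInstance
      V := badPlaces P
      hv := fun v => (-(ord P.F v (jInv P.x))).toNat
      fv := fun v => resDeg P.F v
      one_le_fv := fun v _ => Nat.pos_of_ne_zero (resDeg_ne_zero P.F v)
      pv := fun v => residueChar P.F v
      pv_prime := fun v _ => residueChar_prime P.F v
      d := P.degree
      one_le_d := P.degree_pos
      δ := delta d
      two_le_δ := by unfold delta; nlinarith
      d_le_δ := by
        unfold delta
        have : (P.degree : ℝ) ≤ d := by exact_mod_cast hdeg
        nlinarith
      h := logQForall P
      h_def := by
        rw [degree_mul_logQForall_eq_sum_logNorm]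
        refine Finset.sum_congr rfl fun v _ => ?_
        unfold localHeight
        rw [logNorm_eq]
        ring
      ξ := ξ
      isXiPrm := hξ
      ξ_le_sqrt := hξh }
  obtain ⟨l, hl, hP1lo, hP1hi, hP2, hP3⟩ := A.exists_prime_P1_P2_P3
  refine ⟨l, hl, hP1lo, hP1hi, ?_, ?_⟩
  · -- (P2): `l ∤ h_v` for nonzero `h_v`, i.e. `l ∤ ord_v(j)` where `ord_v(j) < 0`
    intro v hv hdvd
    have hvb : v ∈ badPlaces P := (mem_badPlaces_iff_ord_neg P v).mpr hv
    have hne : (-(ord P.F v (jInv P.x))).toNat ≠ 0 := by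
      intro h0; rw [Int.toNat_eq_zero] at h0; omega
    apply hP2 v hvb hne
    have hcast : (((-(ord P.F v (jInv P.x))).toNat : ℕ) : ℤ) = -(ord P.F v (jInv P.x)) :=
      Int.toNat_of_nonneg (by omega)
    have : (l : ℤ) ∣ (((-(ord P.F v (jInv P.x))).toNat : ℕ) : ℤ) := by
      rw [hcast]; exact dvd_neg.mpr hdvd
    exact_mod_cast this
  · intro v hv hres
    exact hP3 v hv hres

/-! ## A real-variable lemma: `𝕍^bad_mod = ∅` bounds `h` (p. 46) -/

/-- `log x ≤ 2·√x` for `x > 0`. [folklore] -/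
private theorem log_le_two_mul_sqrt {x : ℝ} (hx : 0 < x) : Real.log x ≤ 2 * Real.sqrt x := by
  have hs : 0 < Real.sqrt x := Real.sqrt_pos.mpr hx
  have h1 : Real.log (Real.sqrt x) ≤ Real.sqrt x - 1 := Real.log_le_sub_one_of_pos hs
  have h2 : Real.log x = 2 * Real.log (Real.sqrt x) := by
    conv_lhs => rw [← Real.sq_sqrt hx.le]
    rw [Real.log_pow]; norm_num
  linarith

/-- **If `𝕍^bad_mod = ∅` then `h` is bounded** (p. 46: "`h ≈ log(q^{∤2}) ≤ h^{1/2}·log(l) ≤ 16·δ^{1/4}·h^{3/4}`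
— an inequality which implies that `h^{1/4}`, hence `h` itself, is bounded"), as the explicit
real-variable statement the assembly uses: from `h ≥ 1`, `δ ≥ 2`, `l ≤ 10δ·h^{1/2}·log(2δh)` (P1) and
`h ≤ B + h^{1/2}·log(l)` one gets `h ≤ 2^{20}·δ + 4B`. [claim: Mochizuki2012, status: disputed] -/
theorem h_le_of_le_add_sqrt_mul_log {h δ l B : ℝ} (hh : 1 ≤ h) (hδ : 2 ≤ δ) (hB : 0 ≤ B) (hl0 : 0 < l)
    (hl : l ≤ 10 * δ * Real.sqrt h * Real.log (2 * δ * h)) (hbound : h ≤ B + Real.sqrt h * Real.log l) :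
    h ≤ 2 ^ 20 * δ + 4 * B := by
  have hh0 : 0 < h := by linarith
  have hδ0 : 0 < δ := by linarith
  set s := Real.sqrt h with hs
  have hs0 : 0 < s := Real.sqrt_pos.mpr hh0
  have hs2 : s ^ 2 = h := Real.sq_sqrt hh0.le
  have hs1 : 1 ≤ s := by rw [hs, ← Real.sqrt_one]; exact Real.sqrt_le_sqrt hh
  set r := Real.sqrt s with hr
  have hr0 : 0 < r := Real.sqrt_pos.mpr hs0
  have hr2 : r ^ 2 = s := Real.sq_sqrt hs0.le
  have hr1 : 1 ≤ r := by rw [hr, ← Real.sqrt_one]; exact Real.sqrt_le_sqrt hs1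
  -- `l ≤ 20 δ² h²`
  have hlog2δh : Real.log (2 * δ * h) ≤ 2 * δ * h := by
    have := Real.log_le_sub_one_of_pos (show 0 < 2 * δ * h by positivity); linarith
  have hl2 : l ≤ 20 * δ ^ 2 * h ^ 2 := by
    have h1 : 10 * δ * s * Real.log (2 * δ * h) ≤ 10 * δ * s * (2 * δ * h) :=
      mul_le_mul_of_nonneg_left hlog2δh (by positivity)
    have h2 : s ≤ h := by nlinarith
    nlinarith
  -- `log l ≤ 3 + 4√δ + 8 r`
  have hlogl : Real.log l ≤ 3 + 4 * Real.sqrt δ + 8 * r := by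
    have h20 : Real.log 20 ≤ 3 := by
      have : Real.log 20 ≤ Real.log (Real.exp 3) := by
        apply Real.log_le_log (by norm_num)
        have he := Real.exp_one_gt_d9
        have : Real.exp 3 = Real.exp 1 * Real.exp 1 * Real.exp 1 := by
          rw [← Real.exp_add, ← Real.exp_add]; norm_num
        rw [this]; nlinarith
      rwa [Real.log_exp] at this
    have hlogδ : Real.log δ ≤ 2 * Real.sqrt δ := log_le_two_mul_sqrt hδ0
    have hlogh : Real.log h ≤ 4 * r := by
      have e1 : Real.log h = 4 * Real.log r := by
        rw [← hs2, ← hr2, Real.log_pow, Real.log_pow]; push_cast; ring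
      have := Real.log_le_sub_one_of_pos hr0
      linarith
    calc Real.log l ≤ Real.log (20 * δ ^ 2 * h ^ 2) := Real.log_le_log hl0 hl2
      _ = Real.log 20 + 2 * Real.log δ + 2 * Real.log h := by
          rw [Real.log_mul (by positivity) (by positivity), Real.log_mul (by norm_num) (by positivity),
            Real.log_pow, Real.log_pow]; push_cast; ring
      _ ≤ 3 + 4 * Real.sqrt δ + 8 * r := by linarith
  -- if `h ≥ 2^20 δ` then `√h · log l ≤ (3/4) h`, so `h ≤ 4B`; otherwise `h ≤ 2^20 δ`
  by_cases hbig : 2 ^ 20 * δ ≤ h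
  · have hsδ : Real.sqrt δ ≤ s / 16 := by
      -- `256 δ ≤ 2^20 δ ≤ h = s²`
      have h256 : δ ≤ (s / 16) ^ 2 := by rw [div_pow, hs2]; nlinarith
      calc Real.sqrt δ ≤ Real.sqrt ((s / 16) ^ 2) := Real.sqrt_le_sqrt h256
        _ = s / 16 := Real.sqrt_sq (by positivity)
    have hs12 : 12 ≤ s := by nlinarith
    have hr32 : 32 ≤ r := by
      -- `r⁴ = h ≥ 2^20`, so `r ≥ 32`
      by_contra hlt
      rw [not_le] at hlt
      have : r ^ 2 < 32 ^ 2 := by nlinarith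
      have : s < 1024 := by nlinarith
      have : s ^ 2 < 1024 ^ 2 := by nlinarith
      nlinarith
    have key : s * Real.log l ≤ 3 / 4 * h := by
      have a1 : s * 3 ≤ h / 4 := by nlinarith
      have a2 : s * (4 * Real.sqrt δ) ≤ h / 4 := by nlinarith [Real.sqrt_nonneg δ]
      have a3 : s * (8 * r) ≤ h / 4 := by
        have : s * (8 * r) = 8 * r ^ 3 := by rw [← hr2]; ring
        have : h = r ^ 4 := by rw [← hs2, ← hr2]; ring
        nlinarith
      calc s * Real.log l ≤ s * (3 + 4 * Real.sqrt δ + 8 * r) :=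
            mul_le_mul_of_nonneg_left hlogl hs0.le
        _ ≤ 3 / 4 * h := by nlinarith
    nlinarith
  · rw [not_le] at hbig
    nlinarith

end Cor22

end Literature.IUT.LogVolume

end
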